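import Literature.MathematicalPhysics.QuantumFieldTheory.BalabanImbrieJaffe1984to88.BIJ88Eq242HiggsCovarianceTorusCwt
import Literature.MathematicalPhysics.QuantumFieldTheory.BalabanImbrieJaffe1984to88.BIJ88NeumannPropagatorActualBackground

/-!
# `BalabanImbrieJaffe1984to88.BIJ88Eq242HiggsCovarianceActualBackground` — T. Bałaban, J. Imbrie, A. Jaffe, *Effective action and cluster
properties of the abelian Higgs model*, Commun. Math. Phys. **114** (1988) 257–315 [BalabanImbrieJaffe1988], §2 pp. 264–265 [PDF 8–9],
(2.40)–(2.47), together with [BalabanImbrieJaffe1985] = [I], §7.3 p. 326 [PDF 28] (7.3.1) *«The propagators arising from Δ_k(u_k), under the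
restriction (7.3.1) on the gauge field, also satisfy the regularity and decay estimates of [7]»*:
**[6] (5.6) + (2.40)-INVERTIBILITY, (2.42), (2.45), (2.41) (walk route), (2.46), (2.47) FOR THE CONCRETE
`C^{(k)}_Λ(u_k) = [(Δ_{k,loc}(u_k) + (A/a_k)κ′P(u_k′))|_Λ]^{−1}` AT THE ACTUAL BACKGROUND `u_k = actualBgU1 hd2 k e v` OF [I] (4.5.4) UNDER THE
PRINTED (7.3.1) `‖v(∂q) − 1‖ ≤ e𝓅(e)`, `𝓅(e) = (1 + log e⁻¹)^p`, ONE THRESHOLD `e𝓅(e) ≤ c₁ = 1/(23D²K)`** — each member is gen 23's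
small-plaquette theorem of `BIJ88Eq242HiggsCovarianceTorusCwt` (file 2 of this generation: `hyp56_deltaLocT_smallPlaquette_torus_cwt`, `eq242_…`,
`eq245_…`, `decay241_walk_…`, `ineq246_…`, `close247_smallPlaquette_torus_cwt`) with its background data `(u, θ, 0 ≤ θ, ‖u(∂p) − 1‖ ≤ θ,
(L^{2k}θ)² ≤ 1/500)` SUPPLIED by p34 gen 19's passage `BIJ88NeumannPropagatorActualBackground.smallPlaquette_actualBg` at `θ = K·e𝓅(e)/(L^k)²`
— exactly the pattern of p34's `decay110_region_actualBg` and p29's `BIJ88Loc231ActualBackground`.  Nothing is re-derived.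

statement-level skeleton of published theorems with citation tags; proofs where landed; nothing here is a claim about the Yang–Mills mass gap

Print [I] p. 326: *"The propagators arising from Δ_k(u_k), under the restriction (7.3.1) on the gauge field, also satisfy the regularity and
decay estimates of [7]."*; [BIJ88] p. 264: *"by (2.38), C^{(k)}_Λ(u)^{−1} is bounded below and a random walk expansion as in [6] can be used to
prove that |C^{(k)}_Λ(u; x₁, x₂)| ≦ ce^{−c|x₁−x₂|}. (2.41) … C^{(k)}_Λ(u) = Σ_ω C^{(k)}_{Λ,ω}(u), (2.42) … C^{(k)}_Λ(u) = C^{(k)}_{Λ,loc}(u) +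
Σ_X C^{(k)}_{Λ,X}(u), (2.45) … |C^{(k)}_{Λ,X}(u; x₁, x₂)| ≦ e^{−cr(e_k)|X|}. (2.46) … |C^{(k)}_{Λ,loc}(u; x₁, x₂) − C^{(k)}_Λ(u; x₁, x₂)| ≦
e^{−cr(e_k)}e^{−c|x₁−x₂|}. (2.47)"*.

CONTENTS (one section; binder list = file 2's with `(U, θ)` replaced by `(e, v)` under (7.3.1), constants `(c₁, δ₀, c₀, K)` before the instance):
**`hyp56_deltaLocT_actualBg`** ([6] (5.6) `B4.Hyp56 Λ′ (reOp Λ ·) γ₅₆ c₅₆ δ₀` + invertibility, `0 < γ₅₆`, `0 ≤ c₅₆`), **`eq242_actualBg`** ((2.42):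
`C^{(k)}_Λ(u_k; x₁, x₂) = Σ_ω C^ℂ_ω(x₁, x₂)`, unconditional `HasSum` in `ℂ` over all walks), **`eq245_actualBg`** ((2.45), typed
`BIJ88Sect2Statements.Eq245` for the realified entries), **`decay241_walk_actualBg`** ((2.41) by the walk route, torus distance), **`ineq246_actualBg`**
((2.46), typed `Ineq246`), **`close247_actualBg`** ((2.47), typed `Close` in the torus distance); `θ = K·e𝓅(e)/(L^k)²` appears in `γ₅₆ = gamma56 P a k θ …`
and in the largeness condition `E₅₆ < c240(γ₀, κ′)(1 − σ)`.

HONEST SCOPE / DIVERGENCE.  (i) Exactly file 2's (`BIJ88Eq242HiggsCovarianceTorusCwt`) scope (realified coordinates + complex forms; p13's walk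
data and cube-size conditions at `(γ₅₆, c₅₆, δ₀)`; `Ω = T_η`; half-torus reference box; u-locality clauses not instantiated) at the particular
background `u = u_k(e, v)`; the smallness `(T₁, δ′, σ)` of the averaged field `lineIter u_k k` in the `L`-blocks of `T^{(k)}` and the largeness
condition stay DISPLAYED hypotheses, as in gen 22's / r18's actual-background members.  (ii) (7.3.1) is taken on ALL plaquettes of the unit field
`v` (p34's passage); threshold `c₁ = 1/(23D²K(D, L, 𝓅))` with p34's `K`.  (iii) `D = d + 1 ∈ {2, 3}`, `L = ℓ + 1` even-indexed odd (`Odd (ℓ+1)`),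
`1 ≤ k ≤ K`, `k + 1 ≤ m + K` (a next level exists), `2(L^k − 1) + 4 < |T|`.
Imports: gen 23 `BIJ88Eq242HiggsCovarianceTorusCwt` (file 2), p34 gen 19 `BIJ88NeumannPropagatorActualBackground`.  Literature + Mathlib only.
Unit `lit-balaban-p31` (literature-prover-lit-balaban-p31-g23-0), 2026-08-23.  NOT summit progress.
-/

open scoped BigOperators Matrix ComplexConjugate
open Finset Matrix

namespace Literature.MathematicalPhysics.QuantumFieldTheory.BalabanImbrieJaffe1984to88.BIJ88Eq242HiggsCovarianceActualBackground

open Literature.MathematicalPhysics.QuantumFieldTheory.Balaban1983to89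
open BIJ88Sect3Statements (U1 toC)
open BIJ85BlockAveragesTorus BIJ85BlockAveragesTorusK
open BIJ85Sect1Model (U1Field plaq)
open BIJ85AbelianStokes (plaqC)
open BIJ85Eq454PlaqResidual (actualBgU1)
open BIJ88NeumannPropagatorActualBackground (smallPlaquette_actualBg)
open BIJ88DeltaLoc234Torus (deltaLocT)
open BIJ88Cutoffs21 (cutoff)
open BIJ88LocWeights227Torus (cubeFam lamFam)
open BIJ88Eq240FlatTorus (realify compress op240 c240)
open B4Sect5Proof (latticeConst)
open BIJ88RandomWalk242 BIJ88Eq242Lattice BIJ88Ineq246Lattice B4Sect5CubeBounds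
open BIJ88Eq242HiggsCovarianceTorus (chartSet reOp idxEquiv)
open BIJ88Eq242HiggsCovarianceTorusCwt

noncomputable section

variable {d : ℕ}

/-- **[6] (5.6) AND (2.40)-INVERTIBILITY FOR `(Δ_{k,loc}(u_k) + (A/a_k)κ′P(u_k′))|_Λ` AT THE ACTUAL BACKGROUND UNDER THE PRINTED (7.3.1).**  For
`D = d + 1 ∈ {2, 3}`, odd `L = ℓ + 1 ≥ 2`, `a > 0`, exponent `𝓅`: there are `c₁ > 0` (`= 1/(23D²K)`), `δ₀, c₀ > 0` and `K ≥ 1` such that for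
every torus (`P.d = D`, `P.L = L`), every `1 ≤ k ≤ K_P` with `k + 1 ≤ m + K_P` and `2(L^k − 1) + 4 < |T|`, every `0 < e ≤ 1` with `e𝓅(e) ≤ c₁`,
every unit field `v` with (7.3.1), and then file 2's data (half-torus reference box `Ω₀`, label spacing, radii, `Λ` deep in `Ω₀`, smallness
`(T₁, δ′, σ)` of `lineIter u_k k` in the `L`-blocks, `κ′ ≥ 0`, largeness `E₅₆(θ) < c240(γ₀,κ′)(1−σ)` at `θ = K·e𝓅(e)/(L^k)²`):
`0 < γ₅₆ ∧ 0 ≤ c₅₆ ∧ B4.Hyp56 Λ′ (reOp Λ (Δ_{k,loc}(u_k) + (A/a_k)κ′P(u_k′))) γ₅₆ c₅₆ δ₀ ∧ IsUnit ((…)|_Λ)` — file 2's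
`hyp56_deltaLocT_smallPlaquette_torus_cwt` ∘ p34's `smallPlaquette_actualBg`.
[cite: BalabanImbrieJaffe1985, (7.3.1) p.326] [cite: BalabanImbrieJaffe1988, (2.40) p.264] [cite: Balaban1983RegularityDecay, (5.6) p.594] -/
theorem hyp56_deltaLocT_actualBg (d ℓ : ℕ) (hd1 : 1 ≤ d) (hd3 : d + 1 ≤ 3) (hℓ : 1 ≤ ℓ) (hodd : Odd (ℓ + 1)) {a : ℝ} (ha : 0 < a) (pexp : ℝ) :
    ∃ c₁ δ₀ c₀ K : ℝ, 0 < c₁ ∧ 0 < δ₀ ∧ 0 < c₀ ∧ 1 ≤ K ∧ ∀ (P : Params) (hPd : P.d = d + 1), P.L = ℓ + 1 →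
      ∀ (hd2 : 2 ≤ P.d) (k : ℕ), 1 ≤ k → k ≤ P.K → k + 1 ≤ P.m + P.K → 2 * (P.L ^ k - 1) + 4 < P.sitesPerDir 0 →
      ∀ (e : ℝ), 0 < e → e ≤ 1 → e * (1 + Real.log e⁻¹) ^ pexp ≤ c₁ →
      ∀ (v : U1Field P k), (∀ q : Balaban1983to89.Plaq P k, ‖((plaq v q : Circle) : ℂ) - 1‖ ≤ e * (1 + Real.log e⁻¹) ^ pexp) →
      ∀ (c M0 : Fin (d + 1) → ℕ), (∀ i, 1 ≤ M0 i) → (∀ i, c i * P.L ^ k + P.L ^ k * M0 i ≤ P.sitesPerDir 0) →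
        (∀ i, 2 * (P.L ^ k * M0 i) ≤ P.sitesPerDir 0) →
      ∀ (sg W : ℕ), 1 ≤ sg → ∀ (R R₀ R₁ : ℝ), 10 * (P.L : ℝ) ^ k < R → 0 ≤ R₁ → R₁ < R₀ →
        2 * (sg : ℝ) / 3 + R₀ / 2 + R ≤ W → (∀ i, ((P.L ^ k * M0 i : ℕ) : ℝ) + R ≤ P.sitesPerDir 0) →
      ∀ (Λ : Finset (Balaban1983to89.Site P (0 + k))),
        (∀ y₁ ∈ Λ, ∀ μ, (c (Fin.cast hPd μ) : ℝ) * P.L ^ k + (R₀ + R) ≤ (P.L : ℝ) ^ k * (y₁ μ).val ∧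
          (P.L : ℝ) ^ k * (y₁ μ).val + P.L ^ k + (R₀ + R) ≤ (c (Fin.cast hPd μ) : ℝ) * P.L ^ k + (P.L : ℝ) ^ k * M0 (Fin.cast hPd μ)) →
      ∀ (T₁ δ' σ : ℝ),
        (∀ b : PBond P (0 + k), blkIter 1 b.src = blkIter 1 b.tgt → ‖toC (lineIter (actualBgU1 hd2 k e v) k b) - 1‖ ≤ T₁) →
        (∀ y : Balaban1983to89.Site P (0 + k), ‖holCK (lineIter (actualBgU1 hd2 k e v) k) 1 y - 1‖ ≤ δ') →
        2 * (((P.L : ℝ) - 1) * P.L) * P.d * T₁ ^ 2 + 2 * δ' ^ 2 ≤ σ →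
      ∀ (κ' : ℝ), 0 ≤ κ' →
        4 / 3 * (P.d : ℝ) ^ 4 * (((P.L : ℝ) ^ k) ^ 2 * (K * (e * (1 + Real.log e⁻¹) ^ pexp) / ((P.L : ℝ) ^ k) ^ 2)) ^ 2 +
            B1.aSeq a P.L k ^ 2 * (c₀ * Real.exp (δ₀ / 2) * latticeConst P.d (δ₀ / 2)) *
              (((⌊(((P.L : ℝ) ^ k) - 1 + R₀) / sg⌋₊ : ℝ) + 3) ^ (d + 1) *
                  Real.exp (-(δ₀ * (((P.L : ℝ) ^ k)⁻¹ * (2 * R)))) +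
                Real.exp (-(δ₀ / 2 * (((P.L : ℝ) ^ k)⁻¹ * R₁)))) <
          c240 P (min (a / (9 * (P.d + 1))) (1 / 12)) κ' * (1 - σ) →
      0 < gamma56 P a k (K * (e * (1 + Real.log e⁻¹) ^ pexp) / ((P.L : ℝ) ^ k) ^ 2) c₀ δ₀ ((⌊(((P.L : ℝ) ^ k) - 1 + R₀) / sg⌋₊ + 3) ^ (d + 1)) R R₁ σ κ' ∧
      0 ≤ c56 P a k c₀ δ₀ ((⌊(((P.L : ℝ) ^ k) - 1 + R₀) / sg⌋₊ + 3) ^ (d + 1)) κ' ∧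
      B4.Hyp56 (chartSet Λ)
          (reOp Λ (op240
            (deltaLocT (B1RG242Torus.α P a k * (P.L : ℝ) ^ (k * P.d)) P.eps⁻¹ (actualBgU1 hd2 k e v) k (cubeFam hPd (P.L ^ k) c M0 sg W)
              (lamFam hPd (P.L ^ k) c M0 sg) (cutoff R₁ R₀ (B5Ineq137Torus.T P 0)))
            ((B1RG242Torus.α P a k * (P.L : ℝ) ^ (k * P.d)) / B1.aSeq a P.L k * κ') (lineIter (actualBgU1 hd2 k e v) k)))
          (gamma56 P a k (K * (e * (1 + Real.log e⁻¹) ^ pexp) / ((P.L : ℝ) ^ k) ^ 2) c₀ δ₀ ((⌊(((P.L : ℝ) ^ k) - 1 + R₀) / sg⌋₊ + 3) ^ (d + 1)) R R₁ σ κ')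
          (c56 P a k c₀ δ₀ ((⌊(((P.L : ℝ) ^ k) - 1 + R₀) / sg⌋₊ + 3) ^ (d + 1)) κ') δ₀ ∧
      IsUnit (compress Λ (op240
            (deltaLocT (B1RG242Torus.α P a k * (P.L : ℝ) ^ (k * P.d)) P.eps⁻¹ (actualBgU1 hd2 k e v) k (cubeFam hPd (P.L ^ k) c M0 sg W)
              (lamFam hPd (P.L ^ k) c M0 sg) (cutoff R₁ R₀ (B5Ineq137Torus.T P 0)))
            ((B1RG242Torus.α P a k * (P.L : ℝ) ^ (k * P.d)) / B1.aSeq a P.L k * κ') (lineIter (actualBgU1 hd2 k e v) k))) := by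
  obtain ⟨K, hK1, HK⟩ := smallPlaquette_actualBg (d := d + 1) (L := ℓ + 1) (by omega) pexp
  obtain ⟨δ₀, c₀, hδ₀, hc₀, H⟩ := hyp56_deltaLocT_smallPlaquette_torus_cwt d ℓ hd1 hd3 hℓ hodd ha
  refine ⟨1 / (23 * ((d : ℝ) + 1) ^ 2 * K), δ₀, c₀, K, by positivity, hδ₀, hc₀, hK1, ?_⟩
  intro P hPd hPL hd2 k hk1 hkK hk' hbig e he he1 hsm v hv c M0 hM0 hfit0 hhalf sg W hsg R R₀ R₁ hRm hR₁ hR10 hW hgap Λ hΛ T₁ δ' σ hInt hTree hσ κ' hκ' hE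
  have hk : k ≤ P.m + P.K := hkK.trans (Nat.le_add_left _ _)
  have hdr : (P.d : ℝ) = (d : ℝ) + 1 := by rw [hPd]; push_cast; ring
  rw [← hdr] at hsm
  obtain ⟨hθ0, hplaq, -, -, -, -, hτ⟩ := HK P hPd hPL hd2 k hk1 hk e he he1 hsm v hv
  exact H P hPd hPL k hk1 hkK hk' hbig (actualBgU1 hd2 k e v) _ hθ0 hplaq hτ c M0 hM0 hfit0 hhalf sg W hsg R R₀ R₁ hRm hR₁ hR10 hW hgap Λ hΛ T₁ δ' σ
    hInt hTree hσ κ' hκ' hE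

/-- **(2.42) FOR `C^{(k)}_Λ(u_k)` AT THE ACTUAL BACKGROUND UNDER (7.3.1)**: with the data of `hyp56_deltaLocT_actualBg` and cubes `M ≥ 5`,
`M > K_R(γ₅₆, c₅₆, δ₀)`, `M > Θ₁(γ₅₆, c₅₆, δ₀)`, for all `x₁, x₂ ∈ Λ`: `C^{(k)}_Λ(u_k; x₁, x₂) = Σ_ω C^ℂ_ω(x₁, x₂)`, the sum over ALL walks on the
`M`-cubes of the charted `Λ` converging unconditionally in `ℂ` — file 2's `eq242_smallPlaquette_torus_cwt` ∘ p34's passage.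
[cite: BalabanImbrieJaffe1985, (7.3.1) p.326] [cite: BalabanImbrieJaffe1988, (2.42) p.264] -/
theorem eq242_actualBg (d ℓ : ℕ) (hd1 : 1 ≤ d) (hd3 : d + 1 ≤ 3) (hℓ : 1 ≤ ℓ) (hodd : Odd (ℓ + 1)) {a : ℝ} (ha : 0 < a) (pexp : ℝ) :
    ∃ c₁ δ₀ c₀ K : ℝ, 0 < c₁ ∧ 0 < δ₀ ∧ 0 < c₀ ∧ 1 ≤ K ∧ ∀ (P : Params) (hPd : P.d = d + 1), P.L = ℓ + 1 →
      ∀ (hd2 : 2 ≤ P.d) (k : ℕ), 1 ≤ k → k ≤ P.K → k + 1 ≤ P.m + P.K → 2 * (P.L ^ k - 1) + 4 < P.sitesPerDir 0 →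
      ∀ (e : ℝ), 0 < e → e ≤ 1 → e * (1 + Real.log e⁻¹) ^ pexp ≤ c₁ →
      ∀ (v : U1Field P k), (∀ q : Balaban1983to89.Plaq P k, ‖((plaq v q : Circle) : ℂ) - 1‖ ≤ e * (1 + Real.log e⁻¹) ^ pexp) →
      ∀ (c M0 : Fin (d + 1) → ℕ), (∀ i, 1 ≤ M0 i) → (∀ i, c i * P.L ^ k + P.L ^ k * M0 i ≤ P.sitesPerDir 0) →
        (∀ i, 2 * (P.L ^ k * M0 i) ≤ P.sitesPerDir 0) →
      ∀ (sg W : ℕ), 1 ≤ sg → ∀ (R R₀ R₁ : ℝ), 10 * (P.L : ℝ) ^ k < R → 0 ≤ R₁ → R₁ < R₀ →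
        2 * (sg : ℝ) / 3 + R₀ / 2 + R ≤ W → (∀ i, ((P.L ^ k * M0 i : ℕ) : ℝ) + R ≤ P.sitesPerDir 0) →
      ∀ (Λ : Finset (Balaban1983to89.Site P (0 + k))),
        (∀ y₁ ∈ Λ, ∀ μ, (c (Fin.cast hPd μ) : ℝ) * P.L ^ k + (R₀ + R) ≤ (P.L : ℝ) ^ k * (y₁ μ).val ∧
          (P.L : ℝ) ^ k * (y₁ μ).val + P.L ^ k + (R₀ + R) ≤ (c (Fin.cast hPd μ) : ℝ) * P.L ^ k + (P.L : ℝ) ^ k * M0 (Fin.cast hPd μ)) →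
      ∀ (T₁ δ' σ : ℝ),
        (∀ b : PBond P (0 + k), blkIter 1 b.src = blkIter 1 b.tgt → ‖toC (lineIter (actualBgU1 hd2 k e v) k b) - 1‖ ≤ T₁) →
        (∀ y : Balaban1983to89.Site P (0 + k), ‖holCK (lineIter (actualBgU1 hd2 k e v) k) 1 y - 1‖ ≤ δ') →
        2 * (((P.L : ℝ) - 1) * P.L) * P.d * T₁ ^ 2 + 2 * δ' ^ 2 ≤ σ →
      ∀ (κ' : ℝ), 0 ≤ κ' →
        4 / 3 * (P.d : ℝ) ^ 4 * (((P.L : ℝ) ^ k) ^ 2 * (K * (e * (1 + Real.log e⁻¹) ^ pexp) / ((P.L : ℝ) ^ k) ^ 2)) ^ 2 +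
            B1.aSeq a P.L k ^ 2 * (c₀ * Real.exp (δ₀ / 2) * latticeConst P.d (δ₀ / 2)) *
              (((⌊(((P.L : ℝ) ^ k) - 1 + R₀) / sg⌋₊ : ℝ) + 3) ^ (d + 1) *
                  Real.exp (-(δ₀ * (((P.L : ℝ) ^ k)⁻¹ * (2 * R)))) +
                Real.exp (-(δ₀ / 2 * (((P.L : ℝ) ^ k)⁻¹ * R₁)))) <
          c240 P (min (a / (9 * (P.d + 1))) (1 / 12)) κ' * (1 - σ) →
      ∀ (M : ℕ), 5 ≤ M → kR P.d 2 (gamma56 P a k (K * (e * (1 + Real.log e⁻¹) ^ pexp) / ((P.L : ℝ) ^ k) ^ 2) c₀ δ₀ ((⌊(((P.L : ℝ) ^ k) - 1 + R₀) / sg⌋₊ + 3) ^ (d + 1)) R R₁ σ κ') (c56 P a k c₀ δ₀ ((⌊(((P.L : ℝ) ^ k) - 1 + R₀) / sg⌋₊ + 3) ^ (d + 1)) κ') δ₀ < M →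
        thetaConst P.d 2 (gamma56 P a k (K * (e * (1 + Real.log e⁻¹) ^ pexp) / ((P.L : ℝ) ^ k) ^ 2) c₀ δ₀ ((⌊(((P.L : ℝ) ^ k) - 1 + R₀) / sg⌋₊ + 3) ^ (d + 1)) R R₁ σ κ') (c56 P a k c₀ δ₀ ((⌊(((P.L : ℝ) ^ k) - 1 + R₀) / sg⌋₊ + 3) ^ (d + 1)) κ') δ₀ < M →
      ∀ (x₁ x₂ : ↥Λ),
        HasSum (fun ω : Walk ↥(B4Sect5CubeBounds.labels M (chartSet Λ)) =>
            (⟨latticeCw M (chartSet Λ) 2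
                  (reOp Λ (op240
            (deltaLocT (B1RG242Torus.α P a k * (P.L : ℝ) ^ (k * P.d)) P.eps⁻¹ (actualBgU1 hd2 k e v) k (cubeFam hPd (P.L ^ k) c M0 sg W)
              (lamFam hPd (P.L ^ k) c M0 sg) (cutoff R₁ R₀ (B5Ineq137Torus.T P 0)))
            ((B1RG242Torus.α P a k * (P.L : ℝ) ^ (k * P.d)) / B1.aSeq a P.L k * κ') (lineIter (actualBgU1 hd2 k e v) k))) ω (idxEquiv Λ (x₁, 0)) (idxEquiv Λ (x₂, 0)),
              latticeCw M (chartSet Λ) 2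
                  (reOp Λ (op240
            (deltaLocT (B1RG242Torus.α P a k * (P.L : ℝ) ^ (k * P.d)) P.eps⁻¹ (actualBgU1 hd2 k e v) k (cubeFam hPd (P.L ^ k) c M0 sg W)
              (lamFam hPd (P.L ^ k) c M0 sg) (cutoff R₁ R₀ (B5Ineq137Torus.T P 0)))
            ((B1RG242Torus.α P a k * (P.L : ℝ) ^ (k * P.d)) / B1.aSeq a P.L k * κ') (lineIter (actualBgU1 hd2 k e v) k))) ω (idxEquiv Λ (x₁, 1)) (idxEquiv Λ (x₂, 0))⟩ : ℂ))
          ((compress Λ (op240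
            (deltaLocT (B1RG242Torus.α P a k * (P.L : ℝ) ^ (k * P.d)) P.eps⁻¹ (actualBgU1 hd2 k e v) k (cubeFam hPd (P.L ^ k) c M0 sg W)
              (lamFam hPd (P.L ^ k) c M0 sg) (cutoff R₁ R₀ (B5Ineq137Torus.T P 0)))
            ((B1RG242Torus.α P a k * (P.L : ℝ) ^ (k * P.d)) / B1.aSeq a P.L k * κ') (lineIter (actualBgU1 hd2 k e v) k)))⁻¹ x₁ x₂) := by
  obtain ⟨K, hK1, HK⟩ := smallPlaquette_actualBg (d := d + 1) (L := ℓ + 1) (by omega) pexp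
  obtain ⟨δ₀, c₀, hδ₀, hc₀, H⟩ := eq242_smallPlaquette_torus_cwt d ℓ hd1 hd3 hℓ hodd ha
  refine ⟨1 / (23 * ((d : ℝ) + 1) ^ 2 * K), δ₀, c₀, K, by positivity, hδ₀, hc₀, hK1, ?_⟩
  intro P hPd hPL hd2 k hk1 hkK hk' hbig e he he1 hsm v hv c M0 hM0 hfit0 hhalf sg W hsg R R₀ R₁ hRm hR₁ hR10 hW hgap Λ hΛ T₁ δ' σ hInt hTree hσ κ' hκ' hE M hM hMR hMθ x₁ x₂
  have hk : k ≤ P.m + P.K := hkK.trans (Nat.le_add_left _ _)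
  have hdr : (P.d : ℝ) = (d : ℝ) + 1 := by rw [hPd]; push_cast; ring
  rw [← hdr] at hsm
  obtain ⟨hθ0, hplaq, -, -, -, -, hτ⟩ := HK P hPd hPL hd2 k hk1 hk e he he1 hsm v hv
  exact H P hPd hPL k hk1 hkK hk' hbig (actualBgU1 hd2 k e v) _ hθ0 hplaq hτ c M0 hM0 hfit0 hhalf sg W hsg R R₀ R₁ hRm hR₁ hR10 hW hgap Λ hΛ T₁ δ' σ
    hInt hTree hσ κ' hκ' hE M hM hMR hMθ x₁ x₂

/-- **(2.45) FOR `C^{(k)}_Λ(u_k)` AT THE ACTUAL BACKGROUND UNDER (7.3.1)**: with the data of `eq242_actualBg`, every locality radius `ρ` and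
`r(e_k)`-cube side `s`: the realified entries of `C^{(k)}_Λ(u_k)` ARE the local part plus the sum of the `X`-parts (typed `Eq245`) — file 2's
`eq245_smallPlaquette_torus_cwt` ∘ p34's passage. [cite: BalabanImbrieJaffe1985, (7.3.1) p.326] [cite: BalabanImbrieJaffe1988, (2.45) p.264] -/
theorem eq245_actualBg (d ℓ : ℕ) (hd1 : 1 ≤ d) (hd3 : d + 1 ≤ 3) (hℓ : 1 ≤ ℓ) (hodd : Odd (ℓ + 1)) {a : ℝ} (ha : 0 < a) (pexp : ℝ) :
    ∃ c₁ δ₀ c₀ K : ℝ, 0 < c₁ ∧ 0 < δ₀ ∧ 0 < c₀ ∧ 1 ≤ K ∧ ∀ (P : Params) (hPd : P.d = d + 1), P.L = ℓ + 1 →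
      ∀ (hd2 : 2 ≤ P.d) (k : ℕ), 1 ≤ k → k ≤ P.K → k + 1 ≤ P.m + P.K → 2 * (P.L ^ k - 1) + 4 < P.sitesPerDir 0 →
      ∀ (e : ℝ), 0 < e → e ≤ 1 → e * (1 + Real.log e⁻¹) ^ pexp ≤ c₁ →
      ∀ (v : U1Field P k), (∀ q : Balaban1983to89.Plaq P k, ‖((plaq v q : Circle) : ℂ) - 1‖ ≤ e * (1 + Real.log e⁻¹) ^ pexp) →
      ∀ (c M0 : Fin (d + 1) → ℕ), (∀ i, 1 ≤ M0 i) → (∀ i, c i * P.L ^ k + P.L ^ k * M0 i ≤ P.sitesPerDir 0) →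
        (∀ i, 2 * (P.L ^ k * M0 i) ≤ P.sitesPerDir 0) →
      ∀ (sg W : ℕ), 1 ≤ sg → ∀ (R R₀ R₁ : ℝ), 10 * (P.L : ℝ) ^ k < R → 0 ≤ R₁ → R₁ < R₀ →
        2 * (sg : ℝ) / 3 + R₀ / 2 + R ≤ W → (∀ i, ((P.L ^ k * M0 i : ℕ) : ℝ) + R ≤ P.sitesPerDir 0) →
      ∀ (Λ : Finset (Balaban1983to89.Site P (0 + k))),
        (∀ y₁ ∈ Λ, ∀ μ, (c (Fin.cast hPd μ) : ℝ) * P.L ^ k + (R₀ + R) ≤ (P.L : ℝ) ^ k * (y₁ μ).val ∧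
          (P.L : ℝ) ^ k * (y₁ μ).val + P.L ^ k + (R₀ + R) ≤ (c (Fin.cast hPd μ) : ℝ) * P.L ^ k + (P.L : ℝ) ^ k * M0 (Fin.cast hPd μ)) →
      ∀ (T₁ δ' σ : ℝ),
        (∀ b : PBond P (0 + k), blkIter 1 b.src = blkIter 1 b.tgt → ‖toC (lineIter (actualBgU1 hd2 k e v) k b) - 1‖ ≤ T₁) →
        (∀ y : Balaban1983to89.Site P (0 + k), ‖holCK (lineIter (actualBgU1 hd2 k e v) k) 1 y - 1‖ ≤ δ') →
        2 * (((P.L : ℝ) - 1) * P.L) * P.d * T₁ ^ 2 + 2 * δ' ^ 2 ≤ σ →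
      ∀ (κ' : ℝ), 0 ≤ κ' →
        4 / 3 * (P.d : ℝ) ^ 4 * (((P.L : ℝ) ^ k) ^ 2 * (K * (e * (1 + Real.log e⁻¹) ^ pexp) / ((P.L : ℝ) ^ k) ^ 2)) ^ 2 +
            B1.aSeq a P.L k ^ 2 * (c₀ * Real.exp (δ₀ / 2) * latticeConst P.d (δ₀ / 2)) *
              (((⌊(((P.L : ℝ) ^ k) - 1 + R₀) / sg⌋₊ : ℝ) + 3) ^ (d + 1) *
                  Real.exp (-(δ₀ * (((P.L : ℝ) ^ k)⁻¹ * (2 * R)))) +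
                Real.exp (-(δ₀ / 2 * (((P.L : ℝ) ^ k)⁻¹ * R₁)))) <
          c240 P (min (a / (9 * (P.d + 1))) (1 / 12)) κ' * (1 - σ) →
      ∀ (M : ℕ), 5 ≤ M → kR P.d 2 (gamma56 P a k (K * (e * (1 + Real.log e⁻¹) ^ pexp) / ((P.L : ℝ) ^ k) ^ 2) c₀ δ₀ ((⌊(((P.L : ℝ) ^ k) - 1 + R₀) / sg⌋₊ + 3) ^ (d + 1)) R R₁ σ κ') (c56 P a k c₀ δ₀ ((⌊(((P.L : ℝ) ^ k) - 1 + R₀) / sg⌋₊ + 3) ^ (d + 1)) κ') δ₀ < M →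
        thetaConst P.d 2 (gamma56 P a k (K * (e * (1 + Real.log e⁻¹) ^ pexp) / ((P.L : ℝ) ^ k) ^ 2) c₀ δ₀ ((⌊(((P.L : ℝ) ^ k) - 1 + R₀) / sg⌋₊ + 3) ^ (d + 1)) R R₁ σ κ') (c56 P a k c₀ δ₀ ((⌊(((P.L : ℝ) ^ k) - 1 + R₀) / sg⌋₊ + 3) ^ (d + 1)) κ') δ₀ < M →
      ∀ (ρ : ℝ) (s : ℕ),
        BIJ88Sect2Statements.Eq245
          (fun p q : ↥Λ × Fin 2 => realify (compress Λ (op240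
            (deltaLocT (B1RG242Torus.α P a k * (P.L : ℝ) ^ (k * P.d)) P.eps⁻¹ (actualBgU1 hd2 k e v) k (cubeFam hPd (P.L ^ k) c M0 sg W)
              (lamFam hPd (P.L ^ k) c M0 sg) (cutoff R₁ R₀ (B5Ineq137Torus.T P 0)))
            ((B1RG242Torus.α P a k * (P.L : ℝ) ^ (k * P.d)) / B1.aSeq a P.L k * κ') (lineIter (actualBgU1 hd2 k e v) k)))⁻¹ p q)
          (fun p q => cLoc (ldist (N := 2) M) ρ (fun ω y₁ y₂ => latticeCw M (chartSet Λ) 2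
              (reOp Λ (op240
            (deltaLocT (B1RG242Torus.α P a k * (P.L : ℝ) ^ (k * P.d)) P.eps⁻¹ (actualBgU1 hd2 k e v) k (cubeFam hPd (P.L ^ k) c M0 sg W)
              (lamFam hPd (P.L ^ k) c M0 sg) (cutoff R₁ R₀ (B5Ineq137Torus.T P 0)))
            ((B1RG242Torus.α P a k * (P.L : ℝ) ^ (k * P.d)) / B1.aSeq a P.L k * κ') (lineIter (actualBgU1 hd2 k e v) k))) ω y₁ y₂) (idxEquiv Λ p) (idxEquiv Λ q))
          (fun X p q => cX (ldist (N := 2) M) ρ (cubeOf M s) touch (fun ω y₁ y₂ => latticeCw M (chartSet Λ) 2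
              (reOp Λ (op240
            (deltaLocT (B1RG242Torus.α P a k * (P.L : ℝ) ^ (k * P.d)) P.eps⁻¹ (actualBgU1 hd2 k e v) k (cubeFam hPd (P.L ^ k) c M0 sg W)
              (lamFam hPd (P.L ^ k) c M0 sg) (cutoff R₁ R₀ (B5Ineq137Torus.T P 0)))
            ((B1RG242Torus.α P a k * (P.L : ℝ) ^ (k * P.d)) / B1.aSeq a P.L k * κ') (lineIter (actualBgU1 hd2 k e v) k))) ω y₁ y₂) X (idxEquiv Λ p) (idxEquiv Λ q)) := by
  obtain ⟨K, hK1, HK⟩ := smallPlaquette_actualBg (d := d + 1) (L := ℓ + 1) (by omega) pexp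
  obtain ⟨δ₀, c₀, hδ₀, hc₀, H⟩ := eq245_smallPlaquette_torus_cwt d ℓ hd1 hd3 hℓ hodd ha
  refine ⟨1 / (23 * ((d : ℝ) + 1) ^ 2 * K), δ₀, c₀, K, by positivity, hδ₀, hc₀, hK1, ?_⟩
  intro P hPd hPL hd2 k hk1 hkK hk' hbig e he he1 hsm v hv c M0 hM0 hfit0 hhalf sg W hsg R R₀ R₁ hRm hR₁ hR10 hW hgap Λ hΛ T₁ δ' σ hInt hTree hσ κ' hκ' hE M hM hMR hMθ ρ s
  have hk : k ≤ P.m + P.K := hkK.trans (Nat.le_add_left _ _)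
  have hdr : (P.d : ℝ) = (d : ℝ) + 1 := by rw [hPd]; push_cast; ring
  rw [← hdr] at hsm
  obtain ⟨hθ0, hplaq, -, -, -, -, hτ⟩ := HK P hPd hPL hd2 k hk1 hk e he he1 hsm v hv
  exact H P hPd hPL k hk1 hkK hk' hbig (actualBgU1 hd2 k e v) _ hθ0 hplaq hτ c M0 hM0 hfit0 hhalf sg W hsg R R₀ R₁ hRm hR₁ hR10 hW hgap Λ hΛ T₁ δ' σ
    hInt hTree hσ κ' hκ' hE M hM hMR hMθ ρ s

/-- **(2.41) BY THE WALK ROUTE FOR `C^{(k)}_Λ(u_k)` AT THE ACTUAL BACKGROUND UNDER (7.3.1)**: with the data of `eq242_actualBg` and `θ_W < 1`, for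
all `x₁, x₂ ∈ Λ`: `‖C^{(k)}_Λ(u_k; x₁, x₂)‖ ≤ 2·2^{D}γ₅₆^{−1}(1 − θ_W)^{−1}e^{δ₀/4}·e^{−(δ₀/8)|x₁−x₂|_T/M}` — file 2's
`decay241_walk_smallPlaquette_torus_cwt` ∘ p34's passage. [cite: BalabanImbrieJaffe1985, (7.3.1) p.326] [cite: BalabanImbrieJaffe1988, (2.41) p.264] -/
theorem decay241_walk_actualBg (d ℓ : ℕ) (hd1 : 1 ≤ d) (hd3 : d + 1 ≤ 3) (hℓ : 1 ≤ ℓ) (hodd : Odd (ℓ + 1)) {a : ℝ} (ha : 0 < a) (pexp : ℝ) :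
    ∃ c₁ δ₀ c₀ K : ℝ, 0 < c₁ ∧ 0 < δ₀ ∧ 0 < c₀ ∧ 1 ≤ K ∧ ∀ (P : Params) (hPd : P.d = d + 1), P.L = ℓ + 1 →
      ∀ (hd2 : 2 ≤ P.d) (k : ℕ), 1 ≤ k → k ≤ P.K → k + 1 ≤ P.m + P.K → 2 * (P.L ^ k - 1) + 4 < P.sitesPerDir 0 →
      ∀ (e : ℝ), 0 < e → e ≤ 1 → e * (1 + Real.log e⁻¹) ^ pexp ≤ c₁ →
      ∀ (v : U1Field P k), (∀ q : Balaban1983to89.Plaq P k, ‖((plaq v q : Circle) : ℂ) - 1‖ ≤ e * (1 + Real.log e⁻¹) ^ pexp) →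
      ∀ (c M0 : Fin (d + 1) → ℕ), (∀ i, 1 ≤ M0 i) → (∀ i, c i * P.L ^ k + P.L ^ k * M0 i ≤ P.sitesPerDir 0) →
        (∀ i, 2 * (P.L ^ k * M0 i) ≤ P.sitesPerDir 0) →
      ∀ (sg W : ℕ), 1 ≤ sg → ∀ (R R₀ R₁ : ℝ), 10 * (P.L : ℝ) ^ k < R → 0 ≤ R₁ → R₁ < R₀ →
        2 * (sg : ℝ) / 3 + R₀ / 2 + R ≤ W → (∀ i, ((P.L ^ k * M0 i : ℕ) : ℝ) + R ≤ P.sitesPerDir 0) →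
      ∀ (Λ : Finset (Balaban1983to89.Site P (0 + k))),
        (∀ y₁ ∈ Λ, ∀ μ, (c (Fin.cast hPd μ) : ℝ) * P.L ^ k + (R₀ + R) ≤ (P.L : ℝ) ^ k * (y₁ μ).val ∧
          (P.L : ℝ) ^ k * (y₁ μ).val + P.L ^ k + (R₀ + R) ≤ (c (Fin.cast hPd μ) : ℝ) * P.L ^ k + (P.L : ℝ) ^ k * M0 (Fin.cast hPd μ)) →
      ∀ (T₁ δ' σ : ℝ),
        (∀ b : PBond P (0 + k), blkIter 1 b.src = blkIter 1 b.tgt → ‖toC (lineIter (actualBgU1 hd2 k e v) k b) - 1‖ ≤ T₁) →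
        (∀ y : Balaban1983to89.Site P (0 + k), ‖holCK (lineIter (actualBgU1 hd2 k e v) k) 1 y - 1‖ ≤ δ') →
        2 * (((P.L : ℝ) - 1) * P.L) * P.d * T₁ ^ 2 + 2 * δ' ^ 2 ≤ σ →
      ∀ (κ' : ℝ), 0 ≤ κ' →
        4 / 3 * (P.d : ℝ) ^ 4 * (((P.L : ℝ) ^ k) ^ 2 * (K * (e * (1 + Real.log e⁻¹) ^ pexp) / ((P.L : ℝ) ^ k) ^ 2)) ^ 2 +
            B1.aSeq a P.L k ^ 2 * (c₀ * Real.exp (δ₀ / 2) * latticeConst P.d (δ₀ / 2)) *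
              (((⌊(((P.L : ℝ) ^ k) - 1 + R₀) / sg⌋₊ : ℝ) + 3) ^ (d + 1) *
                  Real.exp (-(δ₀ * (((P.L : ℝ) ^ k)⁻¹ * (2 * R)))) +
                Real.exp (-(δ₀ / 2 * (((P.L : ℝ) ^ k)⁻¹ * R₁)))) <
          c240 P (min (a / (9 * (P.d + 1))) (1 / 12)) κ' * (1 - σ) →
      ∀ (M : ℕ), 5 ≤ M → kR P.d 2 (gamma56 P a k (K * (e * (1 + Real.log e⁻¹) ^ pexp) / ((P.L : ℝ) ^ k) ^ 2) c₀ δ₀ ((⌊(((P.L : ℝ) ^ k) - 1 + R₀) / sg⌋₊ + 3) ^ (d + 1)) R R₁ σ κ') (c56 P a k c₀ δ₀ ((⌊(((P.L : ℝ) ^ k) - 1 + R₀) / sg⌋₊ + 3) ^ (d + 1)) κ') δ₀ < M →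
        thetaConst P.d 2 (gamma56 P a k (K * (e * (1 + Real.log e⁻¹) ^ pexp) / ((P.L : ℝ) ^ k) ^ 2) c₀ δ₀ ((⌊(((P.L : ℝ) ^ k) - 1 + R₀) / sg⌋₊ + 3) ^ (d + 1)) R R₁ σ κ') (c56 P a k c₀ δ₀ ((⌊(((P.L : ℝ) ^ k) - 1 + R₀) / sg⌋₊ + 3) ^ (d + 1)) κ') δ₀ < M →
        thetaW P.d 2 (gamma56 P a k (K * (e * (1 + Real.log e⁻¹) ^ pexp) / ((P.L : ℝ) ^ k) ^ 2) c₀ δ₀ ((⌊(((P.L : ℝ) ^ k) - 1 + R₀) / sg⌋₊ + 3) ^ (d + 1)) R R₁ σ κ') (c56 P a k c₀ δ₀ ((⌊(((P.L : ℝ) ^ k) - 1 + R₀) / sg⌋₊ + 3) ^ (d + 1)) κ') δ₀ M < 1 →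
      ∀ (x₁ x₂ : ↥Λ),
        ‖(compress Λ (op240
            (deltaLocT (B1RG242Torus.α P a k * (P.L : ℝ) ^ (k * P.d)) P.eps⁻¹ (actualBgU1 hd2 k e v) k (cubeFam hPd (P.L ^ k) c M0 sg W)
              (lamFam hPd (P.L ^ k) c M0 sg) (cutoff R₁ R₀ (B5Ineq137Torus.T P 0)))
            ((B1RG242Torus.α P a k * (P.L : ℝ) ^ (k * P.d)) / B1.aSeq a P.L k * κ') (lineIter (actualBgU1 hd2 k e v) k)))⁻¹ x₁ x₂‖ ≤
          2 * (2 ^ P.d * (gamma56 P a k (K * (e * (1 + Real.log e⁻¹) ^ pexp) / ((P.L : ℝ) ^ k) ^ 2) c₀ δ₀ ((⌊(((P.L : ℝ) ^ k) - 1 + R₀) / sg⌋₊ + 3) ^ (d + 1)) R R₁ σ κ')⁻¹ *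
              (1 - thetaW P.d 2 (gamma56 P a k (K * (e * (1 + Real.log e⁻¹) ^ pexp) / ((P.L : ℝ) ^ k) ^ 2) c₀ δ₀ ((⌊(((P.L : ℝ) ^ k) - 1 + R₀) / sg⌋₊ + 3) ^ (d + 1)) R R₁ σ κ')
                (c56 P a k c₀ δ₀ ((⌊(((P.L : ℝ) ^ k) - 1 + R₀) / sg⌋₊ + 3) ^ (d + 1)) κ') δ₀ M)⁻¹ *
              Real.exp (δ₀ / 4)) *
            Real.exp (-(δ₀ / 8) * (B5Ineq137Torus.T P (0 + k) x₁.1 x₂.1 / M)) := by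
  obtain ⟨K, hK1, HK⟩ := smallPlaquette_actualBg (d := d + 1) (L := ℓ + 1) (by omega) pexp
  obtain ⟨δ₀, c₀, hδ₀, hc₀, H⟩ := decay241_walk_smallPlaquette_torus_cwt d ℓ hd1 hd3 hℓ hodd ha
  refine ⟨1 / (23 * ((d : ℝ) + 1) ^ 2 * K), δ₀, c₀, K, by positivity, hδ₀, hc₀, hK1, ?_⟩
  intro P hPd hPL hd2 k hk1 hkK hk' hbig e he he1 hsm v hv c M0 hM0 hfit0 hhalf sg W hsg R R₀ R₁ hRm hR₁ hR10 hW hgap Λ hΛ T₁ δ' σ hInt hTree hσ κ' hκ' hE M hM hMR hMθ hθW x₁ x₂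
  have hk : k ≤ P.m + P.K := hkK.trans (Nat.le_add_left _ _)
  have hdr : (P.d : ℝ) = (d : ℝ) + 1 := by rw [hPd]; push_cast; ring
  rw [← hdr] at hsm
  obtain ⟨hθ0, hplaq, -, -, -, -, hτ⟩ := HK P hPd hPL hd2 k hk1 hk e he he1 hsm v hv
  exact H P hPd hPL k hk1 hkK hk' hbig (actualBgU1 hd2 k e v) _ hθ0 hplaq hτ c M0 hM0 hfit0 hhalf sg W hsg R R₀ R₁ hRm hR₁ hR10 hW hgap Λ hΛ T₁ δ' σ
    hInt hTree hσ κ' hκ' hE M hM hMR hMθ hθW x₁ x₂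

/-- **(2.46) (typed `Ineq246`) FOR `C^{(k)}_Λ(u_k)` AT THE ACTUAL BACKGROUND UNDER (7.3.1)**: with the data of `decay241_walk_actualBg`,
`r(e_k)`-cubes of `s ≥ 1` labels, `ρ = s/4`, `K₀ ≤ e^{(δ₀/(128·9^D))s}`: the `X`-parts vanish unless both arguments lie in `X` and
`|C_{Λ,X}| ≤ e^{−c·s·|X|}`, `c = δ₀/(128·9^D)` — file 2's `ineq246_smallPlaquette_torus_cwt` ∘ p34's passage.
[cite: BalabanImbrieJaffe1985, (7.3.1) p.326] [cite: BalabanImbrieJaffe1988, (2.46) p.264] -/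
theorem ineq246_actualBg (d ℓ : ℕ) (hd1 : 1 ≤ d) (hd3 : d + 1 ≤ 3) (hℓ : 1 ≤ ℓ) (hodd : Odd (ℓ + 1)) {a : ℝ} (ha : 0 < a) (pexp : ℝ) :
    ∃ c₁ δ₀ c₀ K : ℝ, 0 < c₁ ∧ 0 < δ₀ ∧ 0 < c₀ ∧ 1 ≤ K ∧ ∀ (P : Params) (hPd : P.d = d + 1), P.L = ℓ + 1 →
      ∀ (hd2 : 2 ≤ P.d) (k : ℕ), 1 ≤ k → k ≤ P.K → k + 1 ≤ P.m + P.K → 2 * (P.L ^ k - 1) + 4 < P.sitesPerDir 0 →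
      ∀ (e : ℝ), 0 < e → e ≤ 1 → e * (1 + Real.log e⁻¹) ^ pexp ≤ c₁ →
      ∀ (v : U1Field P k), (∀ q : Balaban1983to89.Plaq P k, ‖((plaq v q : Circle) : ℂ) - 1‖ ≤ e * (1 + Real.log e⁻¹) ^ pexp) →
      ∀ (c M0 : Fin (d + 1) → ℕ), (∀ i, 1 ≤ M0 i) → (∀ i, c i * P.L ^ k + P.L ^ k * M0 i ≤ P.sitesPerDir 0) →
        (∀ i, 2 * (P.L ^ k * M0 i) ≤ P.sitesPerDir 0) →
      ∀ (sg W : ℕ), 1 ≤ sg → ∀ (R R₀ R₁ : ℝ), 10 * (P.L : ℝ) ^ k < R → 0 ≤ R₁ → R₁ < R₀ →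
        2 * (sg : ℝ) / 3 + R₀ / 2 + R ≤ W → (∀ i, ((P.L ^ k * M0 i : ℕ) : ℝ) + R ≤ P.sitesPerDir 0) →
      ∀ (Λ : Finset (Balaban1983to89.Site P (0 + k))),
        (∀ y₁ ∈ Λ, ∀ μ, (c (Fin.cast hPd μ) : ℝ) * P.L ^ k + (R₀ + R) ≤ (P.L : ℝ) ^ k * (y₁ μ).val ∧
          (P.L : ℝ) ^ k * (y₁ μ).val + P.L ^ k + (R₀ + R) ≤ (c (Fin.cast hPd μ) : ℝ) * P.L ^ k + (P.L : ℝ) ^ k * M0 (Fin.cast hPd μ)) →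
      ∀ (T₁ δ' σ : ℝ),
        (∀ b : PBond P (0 + k), blkIter 1 b.src = blkIter 1 b.tgt → ‖toC (lineIter (actualBgU1 hd2 k e v) k b) - 1‖ ≤ T₁) →
        (∀ y : Balaban1983to89.Site P (0 + k), ‖holCK (lineIter (actualBgU1 hd2 k e v) k) 1 y - 1‖ ≤ δ') →
        2 * (((P.L : ℝ) - 1) * P.L) * P.d * T₁ ^ 2 + 2 * δ' ^ 2 ≤ σ →
      ∀ (κ' : ℝ), 0 ≤ κ' →
        4 / 3 * (P.d : ℝ) ^ 4 * (((P.L : ℝ) ^ k) ^ 2 * (K * (e * (1 + Real.log e⁻¹) ^ pexp) / ((P.L : ℝ) ^ k) ^ 2)) ^ 2 +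
            B1.aSeq a P.L k ^ 2 * (c₀ * Real.exp (δ₀ / 2) * latticeConst P.d (δ₀ / 2)) *
              (((⌊(((P.L : ℝ) ^ k) - 1 + R₀) / sg⌋₊ : ℝ) + 3) ^ (d + 1) *
                  Real.exp (-(δ₀ * (((P.L : ℝ) ^ k)⁻¹ * (2 * R)))) +
                Real.exp (-(δ₀ / 2 * (((P.L : ℝ) ^ k)⁻¹ * R₁)))) <
          c240 P (min (a / (9 * (P.d + 1))) (1 / 12)) κ' * (1 - σ) →
      ∀ (M : ℕ), 5 ≤ M → kR P.d 2 (gamma56 P a k (K * (e * (1 + Real.log e⁻¹) ^ pexp) / ((P.L : ℝ) ^ k) ^ 2) c₀ δ₀ ((⌊(((P.L : ℝ) ^ k) - 1 + R₀) / sg⌋₊ + 3) ^ (d + 1)) R R₁ σ κ') (c56 P a k c₀ δ₀ ((⌊(((P.L : ℝ) ^ k) - 1 + R₀) / sg⌋₊ + 3) ^ (d + 1)) κ') δ₀ < M →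
        thetaConst P.d 2 (gamma56 P a k (K * (e * (1 + Real.log e⁻¹) ^ pexp) / ((P.L : ℝ) ^ k) ^ 2) c₀ δ₀ ((⌊(((P.L : ℝ) ^ k) - 1 + R₀) / sg⌋₊ + 3) ^ (d + 1)) R R₁ σ κ') (c56 P a k c₀ δ₀ ((⌊(((P.L : ℝ) ^ k) - 1 + R₀) / sg⌋₊ + 3) ^ (d + 1)) κ') δ₀ < M →
        thetaW P.d 2 (gamma56 P a k (K * (e * (1 + Real.log e⁻¹) ^ pexp) / ((P.L : ℝ) ^ k) ^ 2) c₀ δ₀ ((⌊(((P.L : ℝ) ^ k) - 1 + R₀) / sg⌋₊ + 3) ^ (d + 1)) R R₁ σ κ') (c56 P a k c₀ δ₀ ((⌊(((P.L : ℝ) ^ k) - 1 + R₀) / sg⌋₊ + 3) ^ (d + 1)) κ') δ₀ M < 1 →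
      ∀ (s : ℕ), 0 < s →
        K0 P.d 2 (gamma56 P a k (K * (e * (1 + Real.log e⁻¹) ^ pexp) / ((P.L : ℝ) ^ k) ^ 2) c₀ δ₀ ((⌊(((P.L : ℝ) ^ k) - 1 + R₀) / sg⌋₊ + 3) ^ (d + 1)) R R₁ σ κ') (c56 P a k c₀ δ₀ ((⌊(((P.L : ℝ) ^ k) - 1 + R₀) / sg⌋₊ + 3) ^ (d + 1)) κ') δ₀ M ≤
          Real.exp (δ₀ / (128 * 9 ^ P.d) * s) →
        BIJ88Sect2Statements.Ineq246 (fun X : Finset (Cubes M s (chartSet Λ)) => X.card)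
          (fun (p : ↥Λ × Fin 2) (X : Finset (Cubes M s (chartSet Λ))) =>
            memX (fun (x : B4.Idx (chartSet Λ) 2) (l : ↥(B4Sect5CubeBounds.labels M (chartSet Λ))) =>
              B4Sect5CubeBounds.InBox M l.1 (x.1 : Fin P.d → ℤ)) (cubeOf M s) touch (idxEquiv Λ p) X)
          (fun X p q => cX (ldist (N := 2) M) ((s : ℝ) / 4) (cubeOf M s) touch (fun ω y₁ y₂ => latticeCw M (chartSet Λ) 2
              (reOp Λ (op240
            (deltaLocT (B1RG242Torus.α P a k * (P.L : ℝ) ^ (k * P.d)) P.eps⁻¹ (actualBgU1 hd2 k e v) k (cubeFam hPd (P.L ^ k) c M0 sg W)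
              (lamFam hPd (P.L ^ k) c M0 sg) (cutoff R₁ R₀ (B5Ineq137Torus.T P 0)))
            ((B1RG242Torus.α P a k * (P.L : ℝ) ^ (k * P.d)) / B1.aSeq a P.L k * κ') (lineIter (actualBgU1 hd2 k e v) k))) ω y₁ y₂) X (idxEquiv Λ p) (idxEquiv Λ q))
          (δ₀ / (128 * 9 ^ P.d)) s := by
  obtain ⟨K, hK1, HK⟩ := smallPlaquette_actualBg (d := d + 1) (L := ℓ + 1) (by omega) pexp
  obtain ⟨δ₀, c₀, hδ₀, hc₀, H⟩ := ineq246_smallPlaquette_torus_cwt d ℓ hd1 hd3 hℓ hodd ha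
  refine ⟨1 / (23 * ((d : ℝ) + 1) ^ 2 * K), δ₀, c₀, K, by positivity, hδ₀, hc₀, hK1, ?_⟩
  intro P hPd hPL hd2 k hk1 hkK hk' hbig e he he1 hsm v hv c M0 hM0 hfit0 hhalf sg W hsg R R₀ R₁ hRm hR₁ hR10 hW hgap Λ hΛ T₁ δ' σ hInt hTree hσ κ' hκ' hE M hM hMR hMθ hθW s hs hlarge
  have hk : k ≤ P.m + P.K := hkK.trans (Nat.le_add_left _ _)
  have hdr : (P.d : ℝ) = (d : ℝ) + 1 := by rw [hPd]; push_cast; ring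
  rw [← hdr] at hsm
  obtain ⟨hθ0, hplaq, -, -, -, -, hτ⟩ := HK P hPd hPL hd2 k hk1 hk e he he1 hsm v hv
  exact H P hPd hPL k hk1 hkK hk' hbig (actualBgU1 hd2 k e v) _ hθ0 hplaq hτ c M0 hM0 hfit0 hhalf sg W hsg R R₀ R₁ hRm hR₁ hR10 hW hgap Λ hΛ T₁ δ' σ
    hInt hTree hσ κ' hκ' hE M hM hMR hMθ hθW s hs hlarge

/-- **(2.47) (typed `Close`, torus distance) FOR `C^{(k)}_Λ(u_k)` AT THE ACTUAL BACKGROUND UNDER (7.3.1)**: with the data of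
`decay241_walk_actualBg` and every locality radius `ρ`:
`Close (|x₁−x₂|_T/M) C_{Λ,loc} (realify C^{(k)}_Λ(u_k)) (2^Dγ₅₆^{−1}(1−θ_W)^{−1}e^{−(δ₀/16)(ρ−3)}) (δ₀/16)` — file 2's `close247_smallPlaquette_torus_cwt` ∘
p34's passage. [cite: BalabanImbrieJaffe1985, (7.3.1) p.326] [cite: BalabanImbrieJaffe1988, (2.47) p.265] -/
theorem close247_actualBg (d ℓ : ℕ) (hd1 : 1 ≤ d) (hd3 : d + 1 ≤ 3) (hℓ : 1 ≤ ℓ) (hodd : Odd (ℓ + 1)) {a : ℝ} (ha : 0 < a) (pexp : ℝ) :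
    ∃ c₁ δ₀ c₀ K : ℝ, 0 < c₁ ∧ 0 < δ₀ ∧ 0 < c₀ ∧ 1 ≤ K ∧ ∀ (P : Params) (hPd : P.d = d + 1), P.L = ℓ + 1 →
      ∀ (hd2 : 2 ≤ P.d) (k : ℕ), 1 ≤ k → k ≤ P.K → k + 1 ≤ P.m + P.K → 2 * (P.L ^ k - 1) + 4 < P.sitesPerDir 0 →
      ∀ (e : ℝ), 0 < e → e ≤ 1 → e * (1 + Real.log e⁻¹) ^ pexp ≤ c₁ →
      ∀ (v : U1Field P k), (∀ q : Balaban1983to89.Plaq P k, ‖((plaq v q : Circle) : ℂ) - 1‖ ≤ e * (1 + Real.log e⁻¹) ^ pexp) →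
      ∀ (c M0 : Fin (d + 1) → ℕ), (∀ i, 1 ≤ M0 i) → (∀ i, c i * P.L ^ k + P.L ^ k * M0 i ≤ P.sitesPerDir 0) →
        (∀ i, 2 * (P.L ^ k * M0 i) ≤ P.sitesPerDir 0) →
      ∀ (sg W : ℕ), 1 ≤ sg → ∀ (R R₀ R₁ : ℝ), 10 * (P.L : ℝ) ^ k < R → 0 ≤ R₁ → R₁ < R₀ →
        2 * (sg : ℝ) / 3 + R₀ / 2 + R ≤ W → (∀ i, ((P.L ^ k * M0 i : ℕ) : ℝ) + R ≤ P.sitesPerDir 0) →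
      ∀ (Λ : Finset (Balaban1983to89.Site P (0 + k))),
        (∀ y₁ ∈ Λ, ∀ μ, (c (Fin.cast hPd μ) : ℝ) * P.L ^ k + (R₀ + R) ≤ (P.L : ℝ) ^ k * (y₁ μ).val ∧
          (P.L : ℝ) ^ k * (y₁ μ).val + P.L ^ k + (R₀ + R) ≤ (c (Fin.cast hPd μ) : ℝ) * P.L ^ k + (P.L : ℝ) ^ k * M0 (Fin.cast hPd μ)) →
      ∀ (T₁ δ' σ : ℝ),
        (∀ b : PBond P (0 + k), blkIter 1 b.src = blkIter 1 b.tgt → ‖toC (lineIter (actualBgU1 hd2 k e v) k b) - 1‖ ≤ T₁) →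
        (∀ y : Balaban1983to89.Site P (0 + k), ‖holCK (lineIter (actualBgU1 hd2 k e v) k) 1 y - 1‖ ≤ δ') →
        2 * (((P.L : ℝ) - 1) * P.L) * P.d * T₁ ^ 2 + 2 * δ' ^ 2 ≤ σ →
      ∀ (κ' : ℝ), 0 ≤ κ' →
        4 / 3 * (P.d : ℝ) ^ 4 * (((P.L : ℝ) ^ k) ^ 2 * (K * (e * (1 + Real.log e⁻¹) ^ pexp) / ((P.L : ℝ) ^ k) ^ 2)) ^ 2 +
            B1.aSeq a P.L k ^ 2 * (c₀ * Real.exp (δ₀ / 2) * latticeConst P.d (δ₀ / 2)) *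
              (((⌊(((P.L : ℝ) ^ k) - 1 + R₀) / sg⌋₊ : ℝ) + 3) ^ (d + 1) *
                  Real.exp (-(δ₀ * (((P.L : ℝ) ^ k)⁻¹ * (2 * R)))) +
                Real.exp (-(δ₀ / 2 * (((P.L : ℝ) ^ k)⁻¹ * R₁)))) <
          c240 P (min (a / (9 * (P.d + 1))) (1 / 12)) κ' * (1 - σ) →
      ∀ (M : ℕ), 5 ≤ M → kR P.d 2 (gamma56 P a k (K * (e * (1 + Real.log e⁻¹) ^ pexp) / ((P.L : ℝ) ^ k) ^ 2) c₀ δ₀ ((⌊(((P.L : ℝ) ^ k) - 1 + R₀) / sg⌋₊ + 3) ^ (d + 1)) R R₁ σ κ') (c56 P a k c₀ δ₀ ((⌊(((P.L : ℝ) ^ k) - 1 + R₀) / sg⌋₊ + 3) ^ (d + 1)) κ') δ₀ < M →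
        thetaConst P.d 2 (gamma56 P a k (K * (e * (1 + Real.log e⁻¹) ^ pexp) / ((P.L : ℝ) ^ k) ^ 2) c₀ δ₀ ((⌊(((P.L : ℝ) ^ k) - 1 + R₀) / sg⌋₊ + 3) ^ (d + 1)) R R₁ σ κ') (c56 P a k c₀ δ₀ ((⌊(((P.L : ℝ) ^ k) - 1 + R₀) / sg⌋₊ + 3) ^ (d + 1)) κ') δ₀ < M →
        thetaW P.d 2 (gamma56 P a k (K * (e * (1 + Real.log e⁻¹) ^ pexp) / ((P.L : ℝ) ^ k) ^ 2) c₀ δ₀ ((⌊(((P.L : ℝ) ^ k) - 1 + R₀) / sg⌋₊ + 3) ^ (d + 1)) R R₁ σ κ') (c56 P a k c₀ δ₀ ((⌊(((P.L : ℝ) ^ k) - 1 + R₀) / sg⌋₊ + 3) ^ (d + 1)) κ') δ₀ M < 1 →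
      ∀ (ρ : ℝ),
        BIJ88Sect2Statements.Close (fun p q : ↥Λ × Fin 2 => B5Ineq137Torus.T P (0 + k) p.1.1 q.1.1 / M)
          (fun p q => cLoc (ldist (N := 2) M) ρ (fun ω y₁ y₂ => latticeCw M (chartSet Λ) 2
              (reOp Λ (op240
            (deltaLocT (B1RG242Torus.α P a k * (P.L : ℝ) ^ (k * P.d)) P.eps⁻¹ (actualBgU1 hd2 k e v) k (cubeFam hPd (P.L ^ k) c M0 sg W)
              (lamFam hPd (P.L ^ k) c M0 sg) (cutoff R₁ R₀ (B5Ineq137Torus.T P 0)))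
            ((B1RG242Torus.α P a k * (P.L : ℝ) ^ (k * P.d)) / B1.aSeq a P.L k * κ') (lineIter (actualBgU1 hd2 k e v) k))) ω y₁ y₂) (idxEquiv Λ p) (idxEquiv Λ q))
          (fun p q => realify (compress Λ (op240
            (deltaLocT (B1RG242Torus.α P a k * (P.L : ℝ) ^ (k * P.d)) P.eps⁻¹ (actualBgU1 hd2 k e v) k (cubeFam hPd (P.L ^ k) c M0 sg W)
              (lamFam hPd (P.L ^ k) c M0 sg) (cutoff R₁ R₀ (B5Ineq137Torus.T P 0)))
            ((B1RG242Torus.α P a k * (P.L : ℝ) ^ (k * P.d)) / B1.aSeq a P.L k * κ') (lineIter (actualBgU1 hd2 k e v) k)))⁻¹ p q)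
          (2 ^ P.d * (gamma56 P a k (K * (e * (1 + Real.log e⁻¹) ^ pexp) / ((P.L : ℝ) ^ k) ^ 2) c₀ δ₀ ((⌊(((P.L : ℝ) ^ k) - 1 + R₀) / sg⌋₊ + 3) ^ (d + 1)) R R₁ σ κ')⁻¹ *
              (1 - thetaW P.d 2 (gamma56 P a k (K * (e * (1 + Real.log e⁻¹) ^ pexp) / ((P.L : ℝ) ^ k) ^ 2) c₀ δ₀ ((⌊(((P.L : ℝ) ^ k) - 1 + R₀) / sg⌋₊ + 3) ^ (d + 1)) R R₁ σ κ')
                (c56 P a k c₀ δ₀ ((⌊(((P.L : ℝ) ^ k) - 1 + R₀) / sg⌋₊ + 3) ^ (d + 1)) κ') δ₀ M)⁻¹ *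
            Real.exp (-(δ₀ / 16 * (ρ - 3)))) (δ₀ / 16) := by
  obtain ⟨K, hK1, HK⟩ := smallPlaquette_actualBg (d := d + 1) (L := ℓ + 1) (by omega) pexp
  obtain ⟨δ₀, c₀, hδ₀, hc₀, H⟩ := close247_smallPlaquette_torus_cwt d ℓ hd1 hd3 hℓ hodd ha
  refine ⟨1 / (23 * ((d : ℝ) + 1) ^ 2 * K), δ₀, c₀, K, by positivity, hδ₀, hc₀, hK1, ?_⟩
  intro P hPd hPL hd2 k hk1 hkK hk' hbig e he he1 hsm v hv c M0 hM0 hfit0 hhalf sg W hsg R R₀ R₁ hRm hR₁ hR10 hW hgap Λ hΛ T₁ δ' σ hInt hTree hσ κ' hκ' hE M hM hMR hMθ hθW ρ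
  have hk : k ≤ P.m + P.K := hkK.trans (Nat.le_add_left _ _)
  have hdr : (P.d : ℝ) = (d : ℝ) + 1 := by rw [hPd]; push_cast; ring
  rw [← hdr] at hsm
  obtain ⟨hθ0, hplaq, -, -, -, -, hτ⟩ := HK P hPd hPL hd2 k hk1 hk e he he1 hsm v hv
  exact H P hPd hPL k hk1 hkK hk' hbig (actualBgU1 hd2 k e v) _ hθ0 hplaq hτ c M0 hM0 hfit0 hhalf sg W hsg R R₀ R₁ hRm hR₁ hR10 hW hgap Λ hΛ T₁ δ' σ
    hInt hTree hσ κ' hκ' hE M hM hMR hMθ hθW ρ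

end

end Literature.MathematicalPhysics.QuantumFieldTheory.BalabanImbrieJaffe1984to88.BIJ88Eq242HiggsCovarianceActualBackground
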